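import Summits.CriticalPhenomena.PercolationContinuityZ3.Theorems.PercShatteringRaceNearLinearTwoClusterDecayOfShellNonCertainty
import Mathlib.Analysis.SpecialFunctions.Pow.Asymptotics

/-!
# `NearLinearTwoClusterDecay` (stmt-CriticalPhenomena-5785) from POLYLOG-SPARSE shell non-certainty
# (line `critical-orange-peeling`: the weakest per-skin input the peel product can use)

Route `PercShatteringRace`, crux `U(1/6)`.  The companion file
`PercShatteringRaceNearLinearTwoClusterDecayOfShellNonCertainty` reduces the crux to ONE
bounded-aspect statement with a CONSTANT defect: `P_{p_c}(Sh(M^ℓ N, M^{ℓ+1} N)) ≤ 1 - ε` on one skin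
of every window of `L` consecutive skins.  Since the aspect `n^{1/6}` buys `≍ log n` skins, the peel
product in fact tolerates a defect that DECAYS like an inverse power `σ < 1` of `log N` (the exact
slack recorded in the crux's atom census, §3.9: `Σ_skins defect = ∞` over `[n, n^{7/6}]` suffices).
This file certifies that weakest natural form:

* `NearLinearTwoClusterDecayPeelChain.tendsto_of_peelChain_log` — abstract: arrays `a, s ∈ [0,1]`
  with the one-skin peel `a n m' ≤ a n m · s m m'` (`n ≤ m < m'`); if for some `M ≥ 2`, `0 ≤ σ < 1`,
  `c > 0`, `L`, eventually every window `{Sh(M^ℓ N, M^{ℓ+1} N)}_{ℓ<L}` has a skin with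
  `s ≤ 1 - c / (log N)^σ`, then `a n ⌈n^α⌉ → 0` for EVERY `α > 1`.  Proof: block induction with the
  antitone defect `η(T) = c/(log T)^σ` gives `a n (M^{bL} n) ≤ (1 - η(M^{bL} n))^b`; with
  `b(n) = ⌈K (α log n)^σ / c⌉` blocks (`K = log(2/δ)`) one still has `M^{bL} n ≤ n^α` for large `n`
  because `(log n)^σ = o(log n)`, and then `a ≤ (1 - c/(α log n)^σ)^b ≤ exp(-b c/(α log n)^σ) ≤ δ/2`.
* `nearLinearTwoClusterDecay_of_sparseShellNonCertainty` — the crux BY NAME from the polylog-sparse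
  shell non-certainty at `p_c` (spelled inline); `critBoxTwoArmsDecay_of_sparseShellNonCertainty` —
  the same for `PercFiniteBoxLRO.CritBoxTwoArmsDecay` (stmt-CriticalPhenomena-0859).
  The constant form (`σ = 0`) is the companion file's hypothesis.
* `nearLinearTwoClusterDecay_of_fixedAspectShellNonCertainty` (+ `critBoxTwoArmsDecay_…`) — the
  CLEAN bounded-aspect form `NP_M`: `∃ M ≥ 2, ε > 0, ∀ᶠ N, P_{p_c}(Sh(N, M N)) ≤ 1 - ε` ⇒ both cruxes
  (window `L = 1`). So any of: clean `NP_M` ⇒ window form ⇒ polylog-sparse window form closes the crux.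

References: G. Grimmett, *Percolation* (1999), §7.4 Lemma (7.89) (orange peeling); crux protocol files
of stmt-5785 (`Cruxes/NearLinearTwoClusterDecay/AtomCensus-ideator1-g2.md` §3.9, polylog budget).
-/

noncomputable section

open MeasureTheory Filter Real
open scoped Topology
open Literature.Probability.Percolation Literature.Probability.LatticeModels

namespace Summit.CriticalPhenomena.PercolationContinuityZ3.Theorems

namespace NearLinearTwoClusterDecayPeelChain

section Abstract

variable {a s : ℕ → ℕ → ℝ}

/-- The log-defect `c / (log T)^σ` is antitone in `T ≥ 3` for `σ ≥ 0`. -/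
theorem logDefect_antitone {σ c : ℝ} (hσ0 : 0 ≤ σ) (hc : 0 ≤ c) {T T' : ℕ} (hT : 3 ≤ T)
    (hTT' : T ≤ T') : c / Real.log T' ^ σ ≤ c / Real.log T ^ σ := by
  have hT3 : (3 : ℝ) ≤ T := by exact_mod_cast hT
  have hlogT : 0 < Real.log T := Real.log_pos (by linarith)
  have hlogle : Real.log T ≤ Real.log T' :=
    Real.log_le_log (by linarith) (by exact_mod_cast hTT')
  exact div_le_div_of_nonneg_left hc (Real.rpow_pos_of_pos hlogT σ)
    (Real.rpow_le_rpow hlogT.le hlogle hσ0)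

/-- **Block induction with a log-decaying defect**: if every window of `L` skins above any `N ≥ N₀`
(`N₀ ≥ 3`) has a skin with `s ≤ 1 - c/(log N)^σ` (`σ ≥ 0`), then for `n ≥ N₀` and every `b`,
`a n (M^{bL} n) ≤ (1 - c / (log (M^{bL} n))^σ)^b`. -/
theorem chain_le_log (ha0 : ∀ n m, 0 ≤ a n m) (ha1 : ∀ n m, a n m ≤ 1) (hs0 : ∀ m m', 0 ≤ s m m')
    (hs1 : ∀ m m', s m m' ≤ 1) (hpeel : ∀ n m m', n ≤ m → m < m' → a n m' ≤ a n m * s m m')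
    {M : ℕ} (hM : 2 ≤ M) {σ c : ℝ} (hσ0 : 0 ≤ σ) (hc : 0 ≤ c) {L N₀ : ℕ} (hN₀ : 3 ≤ N₀)
    (hgood : ∀ N : ℕ, N₀ ≤ N → ∃ ℓ < L,
      s (M ^ ℓ * N) (M ^ (ℓ + 1) * N) ≤ 1 - c / Real.log N ^ σ)
    {n : ℕ} (hn : N₀ ≤ n) :
    ∀ b : ℕ, a n (M ^ (b * L) * n) ≤ (1 - c / Real.log ((M ^ (b * L) * n : ℕ) : ℝ) ^ σ) ^ b := by
  have hn1 : 1 ≤ n := le_trans (by omega) hn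
  intro b
  induction b with
  | zero => rw [pow_zero, zero_mul, pow_zero, one_mul]; exact ha1 n n
  | succ b ih =>
    obtain ⟨ℓ, hℓ, hP⟩ := hgood (M ^ (b * L) * n) (hn.trans (le_chain hM n _))
    have e1 : M ^ ℓ * (M ^ (b * L) * n) = M ^ (b * L + ℓ) * n := by ring
    have e2 : M ^ (ℓ + 1) * (M ^ (b * L) * n) = M ^ (b * L + ℓ + 1) * n := by ring
    rw [e1, e2] at hP
    set η : ℝ := c / Real.log ((M ^ (b * L) * n : ℕ) : ℝ) ^ σ with hη
    set η' : ℝ := c / Real.log ((M ^ ((b + 1) * L) * n : ℕ) : ℝ) ^ σ with hη'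
    have h0η : 0 ≤ 1 - η := (hs0 _ _).trans hP
    have hT3 : 3 ≤ M ^ (b * L) * n := le_trans (hN₀.trans hn) (le_chain hM n _)
    have hηη' : η' ≤ η :=
      logDefect_antitone hσ0 hc hT3 (chain_mono hM n (by nlinarith : b * L ≤ (b + 1) * L))
    have hidx : b * L + ℓ + 1 ≤ (b + 1) * L := by nlinarith
    calc a n (M ^ ((b + 1) * L) * n)
        ≤ a n (M ^ (b * L + ℓ + 1) * n) :=
          antitone_of_peel ha0 hs1 hpeel (le_chain hM n _) (chain_mono hM n hidx)
      _ ≤ a n (M ^ (b * L + ℓ) * n) * s (M ^ (b * L + ℓ) * n) (M ^ (b * L + ℓ + 1) * n) :=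
          hpeel _ _ _ (le_chain hM n _) (chain_lt hM hn1 _)
      _ ≤ a n (M ^ (b * L) * n) * (1 - η) :=
          mul_le_mul (antitone_of_peel ha0 hs1 hpeel (le_chain hM n _)
            (chain_mono hM n (Nat.le_add_right _ _))) hP (hs0 _ _) (ha0 _ _)
      _ ≤ (1 - η) ^ b * (1 - η) := mul_le_mul_of_nonneg_right ih h0η
      _ = (1 - η) ^ (b + 1) := (pow_succ _ _).symm
      _ ≤ (1 - η') ^ (b + 1) := pow_le_pow_left₀ h0η (by linarith) _

/-- `(log n)^(σ-1) → 0` along the naturals, for `σ < 1`. -/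
theorem tendsto_log_rpow_sub_one {σ : ℝ} (hσ1 : σ < 1) :
    Tendsto (fun n : ℕ => Real.log n ^ (σ - 1)) atTop (𝓝 0) := by
  have h1 : Tendsto (fun x : ℝ => x ^ (-(1 - σ))) atTop (𝓝 0) := tendsto_rpow_neg_atTop (by linarith)
  have h2 := h1.comp (Real.tendsto_log_atTop.comp tendsto_natCast_atTop_atTop)
  refine h2.congr fun n => ?_
  simp only [Function.comp_apply]
  congr 1
  ring

/-- **The abstract orange-peeling lemma, polylog-sparse form**: peel + one skin with defect
`≥ c/(log N)^σ` (`0 ≤ σ < 1`) in every window of `L` skins of every geometric chain above large `N`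
⇒ `a n ⌈n^α⌉ → 0` for every `α > 1`. -/
theorem tendsto_of_peelChain_log (ha0 : ∀ n m, 0 ≤ a n m) (ha1 : ∀ n m, a n m ≤ 1)
    (hs0 : ∀ m m', 0 ≤ s m m') (hs1 : ∀ m m', s m m' ≤ 1)
    (hpeel : ∀ n m m', n ≤ m → m < m' → a n m' ≤ a n m * s m m')
    {M : ℕ} (hM : 2 ≤ M) {σ : ℝ} (hσ0 : 0 ≤ σ) (hσ1 : σ < 1) {c : ℝ} (hc : 0 < c) {L : ℕ}
    (hgood : ∀ᶠ N : ℕ in atTop, ∃ ℓ < L, s (M ^ ℓ * N) (M ^ (ℓ + 1) * N) ≤ 1 - c / Real.log N ^ σ)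
    {α : ℝ} (hα : 1 < α) :
    Tendsto (fun n : ℕ => a n ⌈(n : ℝ) ^ α⌉₊) atTop (𝓝 0) := by
  -- thresholds
  obtain ⟨N₀', hN₀'⟩ := eventually_atTop.1 hgood
  set N₀ : ℕ := max N₀' 3 with hN₀def
  have hN₀3 : 3 ≤ N₀ := le_max_right _ _
  have hgood' : ∀ N : ℕ, N₀ ≤ N → ∃ ℓ < L,
      s (M ^ ℓ * N) (M ^ (ℓ + 1) * N) ≤ 1 - c / Real.log N ^ σ :=
    fun N hN => hN₀' N (le_trans (le_max_left _ _) hN)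
  have hM1 : (1 : ℝ) < M := by exact_mod_cast (lt_of_lt_of_le (by norm_num) hM)
  have hlogM : 0 < Real.log M := Real.log_pos hM1
  have hα0 : (0 : ℝ) < α := by linarith
  rw [Metric.tendsto_atTop]
  intro δ hδ
  -- number of blocks: b(n) = ⌈K₊ (α log n)^σ / c⌉ with K = log (2/δ)
  set K : ℝ := max (Real.log (2 / δ)) 0 with hKdef
  have hK0 : 0 ≤ K := le_max_right _ _
  have hδ2 : (0 : ℝ) < 2 / δ := by positivity
  have hexpK : Real.exp (-K) ≤ δ / 2 :=
    calc Real.exp (-K) ≤ Real.exp (-Real.log (2 / δ)) :=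
          Real.exp_le_exp.2 (neg_le_neg (le_max_left _ _))
      _ = δ / 2 := by rw [Real.exp_neg, Real.exp_log hδ2, inv_div]
  set b : ℕ → ℕ := fun n => ⌈K * (α * Real.log n) ^ σ / c⌉₊ with hbdef
  -- (log n)^σ = o(log n): eventually (K α^σ (log n)^σ / c + 1) · L · log M ≤ (α - 1) · log n
  have hsmall : ∀ᶠ n : ℕ in atTop,
      (K * (α * Real.log n) ^ σ / c + 1) * (L * Real.log M) ≤ (α - 1) * Real.log n := by
    have ht1 : Tendsto (fun n : ℕ => Real.log n ^ (σ - 1)) atTop (𝓝 0) :=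
      tendsto_log_rpow_sub_one hσ1
    have ht2 : Tendsto (fun n : ℕ => (Real.log n)⁻¹) atTop (𝓝 0) :=
      tendsto_inv_atTop_zero.comp (Real.tendsto_log_atTop.comp tendsto_natCast_atTop_atTop)
    have ht : Tendsto (fun n : ℕ => (K * α ^ σ / c * (L * Real.log M)) * Real.log n ^ (σ - 1) +
        (L * Real.log M) * (Real.log n)⁻¹) atTop (𝓝 0) := by
      simpa using (ht1.const_mul (K * α ^ σ / c * (L * Real.log M))).add
        (ht2.const_mul (L * Real.log M))
    have hev := Filter.Tendsto.eventually_lt_const (v := (0 : ℝ)) (u := α - 1) (by linarith) ht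
    filter_upwards [hev, eventually_ge_atTop 3] with n hn hn3
    have hn3' : (3 : ℝ) ≤ n := by exact_mod_cast hn3
    have hlog : 0 < Real.log n := Real.log_pos (by linarith)
    have hmul := (mul_le_mul_of_nonneg_right hn.le hlog.le)
    have e1 : Real.log (n : ℝ) ^ (σ - 1) * Real.log n = Real.log n ^ σ := by
      rw [← Real.rpow_add_one hlog.ne']; ring_nf
    have e2 : (Real.log (n : ℝ))⁻¹ * Real.log n = 1 := inv_mul_cancel₀ hlog.ne'
    have e3 : (α * Real.log n) ^ σ = α ^ σ * Real.log n ^ σ := Real.mul_rpow hα0.le hlog.le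
    have hR : ((K * α ^ σ / c * (L * Real.log M)) * Real.log n ^ (σ - 1) +
        (L * Real.log M) * (Real.log n)⁻¹) * Real.log n
        = (K * α ^ σ / c * (L * Real.log M)) * Real.log n ^ σ + L * Real.log M := by
      linear_combination (K * α ^ σ / c * (L * Real.log M)) * e1 + (L * Real.log M) * e2
    calc (K * (α * Real.log n) ^ σ / c + 1) * (L * Real.log M)
        = (K * α ^ σ / c * (L * Real.log M)) * Real.log n ^ σ + L * Real.log M := by
          rw [e3]; ring
      _ = ((K * α ^ σ / c * (L * Real.log M)) * Real.log n ^ (σ - 1) +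
            (L * Real.log M) * (Real.log n)⁻¹) * Real.log n := hR.symm
      _ ≤ (α - 1) * Real.log n := hmul
  -- the blocks fit under the outer radius: M^{b L} n ≤ n^α ≤ ⌈n^α⌉₊
  have hfit : ∀ᶠ n : ℕ in atTop, ((M ^ (b n * L) * n : ℕ) : ℝ) ≤ (n : ℝ) ^ α := by
    filter_upwards [hsmall, eventually_ge_atTop 3] with n hn hn3
    have hn3' : (3 : ℝ) ≤ n := by exact_mod_cast hn3
    have hn0 : (0 : ℝ) < n := by linarith
    have hlog : 0 < Real.log n := Real.log_pos (by linarith)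
    have hb1 : (b n : ℝ) ≤ K * (α * Real.log n) ^ σ / c + 1 := by
      have hr : 0 ≤ K * (α * Real.log n) ^ σ / c := by positivity
      exact (Nat.ceil_lt_add_one hr).le
    have hexp : (b n : ℝ) * L * Real.log M ≤ (α - 1) * Real.log n := by
      calc (b n : ℝ) * L * Real.log M = (b n : ℝ) * (L * Real.log M) := by ring
        _ ≤ (K * (α * Real.log n) ^ σ / c + 1) * (L * Real.log M) :=
            mul_le_mul_of_nonneg_right hb1 (by positivity)
        _ ≤ (α - 1) * Real.log n := hn
    have hpow : ((M : ℝ) ^ (b n * L)) ≤ (n : ℝ) ^ (α - 1) := by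
      rw [← Real.rpow_natCast, Real.rpow_def_of_pos (by linarith), Real.rpow_def_of_pos hn0]
      refine Real.exp_le_exp.2 ?_
      calc Real.log M * ((b n * L : ℕ) : ℝ) = (b n : ℝ) * L * Real.log M := by push_cast; ring
        _ ≤ (α - 1) * Real.log n := hexp
        _ = Real.log n * (α - 1) := by ring
    calc ((M ^ (b n * L) * n : ℕ) : ℝ) = (M : ℝ) ^ (b n * L) * n := by push_cast; ring
      _ ≤ (n : ℝ) ^ (α - 1) * (n : ℝ) ^ (1 : ℝ) := by
          rw [Real.rpow_one]; exact mul_le_mul_of_nonneg_right hpow hn0.le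
      _ = (n : ℝ) ^ α := by rw [← Real.rpow_add hn0]; ring_nf
  obtain ⟨N₁, hN₁⟩ := eventually_atTop.1 hfit
  refine ⟨max N₀ N₁, fun n hn => ?_⟩
  have hnN₀ : N₀ ≤ n := le_trans (le_max_left _ _) hn
  have hnN₁ : N₁ ≤ n := le_trans (le_max_right _ _) hn
  have hn3 : 3 ≤ n := hN₀3.trans hnN₀
  have hn3' : (3 : ℝ) ≤ n := by exact_mod_cast hn3
  have hn0 : (0 : ℝ) < n := by linarith
  have hlog : 0 < Real.log n := Real.log_pos (by linarith)
  have hfitn := hN₁ n hnN₁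
  have hfit_nat : M ^ (b n * L) * n ≤ ⌈(n : ℝ) ^ α⌉₊ := by
    have : ((M ^ (b n * L) * n : ℕ) : ℝ) ≤ ((⌈(n : ℝ) ^ α⌉₊ : ℕ) : ℝ) := hfitn.trans (Nat.le_ceil _)
    exact_mod_cast this
  -- the defect at the top scale dominates c/(α log n)^σ, and is ≤ 1
  set T : ℕ := M ^ (b n * L) * n with hTdef
  have hT3 : 3 ≤ T := hn3.trans (le_chain hM n _)
  have hT0 : (0 : ℝ) < T := by exact_mod_cast (lt_of_lt_of_le (by norm_num) hT3)
  have hlogT : 0 < Real.log T := Real.log_pos (by exact_mod_cast (lt_of_lt_of_le (by norm_num) hT3))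
  have hlogT_le : Real.log T ≤ α * Real.log n := by
    calc Real.log T ≤ Real.log ((n : ℝ) ^ α) := Real.log_le_log hT0 hfitn
      _ = α * Real.log n := Real.log_rpow hn0 α
  set x : ℝ := c / (α * Real.log n) ^ σ with hxdef
  have hαlog : 0 < α * Real.log n := mul_pos hα0 hlog
  have hx0 : 0 < x := div_pos hc (Real.rpow_pos_of_pos hαlog σ)
  have hx_le : x ≤ c / Real.log T ^ σ :=
    div_le_div_of_nonneg_left hc.le (Real.rpow_pos_of_pos hlogT σ)
      (Real.rpow_le_rpow hlogT.le hlogT_le hσ0)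
  have hdef_le_one : c / Real.log T ^ σ ≤ 1 := by
    -- from the good skin above `n` itself: `0 ≤ s ≤ 1 - c/(log n)^σ`, and antitonicity `n ≤ T`
    obtain ⟨ℓ, -, hℓ⟩ := hgood' n hnN₀
    have h1 : c / Real.log n ^ σ ≤ 1 := by linarith [hs0 (M ^ ℓ * n) (M ^ (ℓ + 1) * n)]
    exact (logDefect_antitone hσ0 hc.le hn3 (le_chain hM n _)).trans h1
  -- conclude
  rw [Real.dist_0_eq_abs, abs_of_nonneg (ha0 _ _)]
  calc a n ⌈(n : ℝ) ^ α⌉₊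
      ≤ a n T := antitone_of_peel ha0 hs1 hpeel (le_chain hM n _) hfit_nat
    _ ≤ (1 - c / Real.log T ^ σ) ^ b n :=
        chain_le_log ha0 ha1 hs0 hs1 hpeel hM hσ0 hc.le hN₀3 hgood' hnN₀ (b n)
    _ ≤ (1 - x) ^ b n := pow_le_pow_left₀ (by linarith) (by linarith) _
    _ ≤ Real.exp (-x) ^ b n := pow_le_pow_left₀ (by linarith) (by
        have := Real.add_one_le_exp (-x)
        linarith) _
    _ = Real.exp (-(b n * x)) := by rw [← Real.exp_nat_mul]; ring_nf
    _ ≤ Real.exp (-K) := by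
        refine Real.exp_le_exp.2 (neg_le_neg ?_)
        have hb : K * (α * Real.log n) ^ σ / c ≤ b n := Nat.le_ceil _
        have e : K = K * (α * Real.log n) ^ σ / c * x := by
          rw [hxdef]; field_simp
        rw [e]
        exact mul_le_mul_of_nonneg_right hb hx0.le
    _ ≤ δ / 2 := hexpK
    _ < δ := by linarith

end Abstract

end NearLinearTwoClusterDecayPeelChain

open NearLinearTwoClusterDecayPeelChain

/-! ## The crux and `CritBoxTwoArmsDecay` from polylog-sparse shell non-certainty at `p_c` -/

/-- **Two-cluster decay at every aspect exponent from POLYLOG-SPARSE shell non-certainty** (every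
`p`): if for some `M ≥ 2`, `0 ≤ σ < 1`, `c > 0`, `L`, eventually every window of `L` consecutive
skins of the geometric chain above `N` contains a skin `Sh(M^ℓ N, M^{ℓ+1} N)` of `P_p`-probability
`≤ 1 - c/(log N)^σ`, then `P_p(A₂(n, ⌈n^α⌉)) → 0` for every `α > 1`. -/
theorem tendsto_real_twoCluster_of_sparseShellNonCertainty (p : unitInterval)
    (h : ∃ M : ℕ, 2 ≤ M ∧ ∃ σ : ℝ, 0 ≤ σ ∧ σ < 1 ∧ ∃ c : ℝ, 0 < c ∧ ∃ L : ℕ,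
      ∀ᶠ N : ℕ in atTop, ∃ ℓ < L,
      (bondPercolation (zdGraph 3) p).real
          {ω | ∃ u ∈ (↑(box 3 (M ^ ℓ * N + 1)) : Set (Site 3)) \ ↑(box 3 (M ^ ℓ * N)),
            ∃ u' ∈ (↑(box 3 (M ^ ℓ * N + 1)) : Set (Site 3)) \ ↑(box 3 (M ^ ℓ * N)),
            ∃ v ∈ innerBoundary (zdGraph 3) (box 3 (M ^ (ℓ + 1) * N)),
            ∃ v' ∈ innerBoundary (zdGraph 3) (box 3 (M ^ (ℓ + 1) * N)),
              ω ∈ openConnIn ((↑(box 3 (M ^ (ℓ + 1) * N)) : Set (Site 3)) \ ↑(box 3 (M ^ ℓ * N))) u v ∧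
              ω ∈ openConnIn ((↑(box 3 (M ^ (ℓ + 1) * N)) : Set (Site 3)) \ ↑(box 3 (M ^ ℓ * N))) u' v' ∧
              ω ∉ openConnIn ((↑(box 3 (M ^ (ℓ + 1) * N)) : Set (Site 3)) \ ↑(box 3 (M ^ ℓ * N))) u u'}
        ≤ 1 - c / Real.log N ^ σ)
    {α : ℝ} (hα : 1 < α) :
    Tendsto (fun n : ℕ => (bondPercolation (zdGraph 3) p).real
      {ω | ∃ x ∈ box 3 n, ∃ x' ∈ box 3 n, ∃ y ∈ innerBoundary (zdGraph 3) (box 3 ⌈(n : ℝ) ^ α⌉₊),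
        ∃ y' ∈ innerBoundary (zdGraph 3) (box 3 ⌈(n : ℝ) ^ α⌉₊),
          ω ∈ openConnIn (↑(box 3 ⌈(n : ℝ) ^ α⌉₊) : Set (Site 3)) x y ∧
          ω ∈ openConnIn (↑(box 3 ⌈(n : ℝ) ^ α⌉₊) : Set (Site 3)) x' y' ∧
          ω ∉ openConnIn (↑(box 3 ⌈(n : ℝ) ^ α⌉₊) : Set (Site 3)) x x'}) atTop (𝓝 0) := by
  obtain ⟨M, hM, σ, hσ0, hσ1, c, hc, L, hgood⟩ := h
  set a : ℕ → ℕ → ℝ := fun n m => (bondPercolation (zdGraph 3) p).real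
      {ω | ∃ x ∈ box 3 n, ∃ x' ∈ box 3 n, ∃ y ∈ innerBoundary (zdGraph 3) (box 3 m),
        ∃ y' ∈ innerBoundary (zdGraph 3) (box 3 m),
          ω ∈ openConnIn (↑(box 3 m) : Set (Site 3)) x y ∧
          ω ∈ openConnIn (↑(box 3 m) : Set (Site 3)) x' y' ∧
          ω ∉ openConnIn (↑(box 3 m) : Set (Site 3)) x x'} with ha
  set s : ℕ → ℕ → ℝ := fun m m' => (bondPercolation (zdGraph 3) p).real
      {ω | ∃ u ∈ (↑(box 3 (m + 1)) : Set (Site 3)) \ ↑(box 3 m),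
        ∃ u' ∈ (↑(box 3 (m + 1)) : Set (Site 3)) \ ↑(box 3 m),
        ∃ v ∈ innerBoundary (zdGraph 3) (box 3 m'),
        ∃ v' ∈ innerBoundary (zdGraph 3) (box 3 m'),
          ω ∈ openConnIn ((↑(box 3 m') : Set (Site 3)) \ ↑(box 3 m)) u v ∧
          ω ∈ openConnIn ((↑(box 3 m') : Set (Site 3)) \ ↑(box 3 m)) u' v' ∧
          ω ∉ openConnIn ((↑(box 3 m') : Set (Site 3)) \ ↑(box 3 m)) u u'} with hs
  exact tendsto_of_peelChain_log (a := a) (s := s) (fun _ _ => measureReal_nonneg)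
    (fun _ _ => measureReal_le_one) (fun _ _ => measureReal_nonneg) (fun _ _ => measureReal_le_one)
    (fun n m m' hnm hmm' => real_twoCluster_peel p hnm hmm') hM hσ0 hσ1 hc (L := L) hgood hα

/-- **`NearLinearTwoClusterDecay` from polylog-sparse shell non-certainty at `p_c`** (the weakest
per-skin hypothesis the orange-peeling product can use; `σ = 0` is the constant form). -/
theorem nearLinearTwoClusterDecay_of_sparseShellNonCertainty
    (h : ∃ M : ℕ, 2 ≤ M ∧ ∃ σ : ℝ, 0 ≤ σ ∧ σ < 1 ∧ ∃ c : ℝ, 0 < c ∧ ∃ L : ℕ,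
      ∀ᶠ N : ℕ in atTop, ∃ ℓ < L,
      (bondPercolation (zdGraph 3) (criticalProbI 3)).real
          {ω | ∃ u ∈ (↑(box 3 (M ^ ℓ * N + 1)) : Set (Site 3)) \ ↑(box 3 (M ^ ℓ * N)),
            ∃ u' ∈ (↑(box 3 (M ^ ℓ * N + 1)) : Set (Site 3)) \ ↑(box 3 (M ^ ℓ * N)),
            ∃ v ∈ innerBoundary (zdGraph 3) (box 3 (M ^ (ℓ + 1) * N)),
            ∃ v' ∈ innerBoundary (zdGraph 3) (box 3 (M ^ (ℓ + 1) * N)),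
              ω ∈ openConnIn ((↑(box 3 (M ^ (ℓ + 1) * N)) : Set (Site 3)) \ ↑(box 3 (M ^ ℓ * N))) u v ∧
              ω ∈ openConnIn ((↑(box 3 (M ^ (ℓ + 1) * N)) : Set (Site 3)) \ ↑(box 3 (M ^ ℓ * N))) u' v' ∧
              ω ∉ openConnIn ((↑(box 3 (M ^ (ℓ + 1) * N)) : Set (Site 3)) \ ↑(box 3 (M ^ ℓ * N))) u u'}
        ≤ 1 - c / Real.log N ^ σ) :
    Summit.CriticalPhenomena.PercolationContinuityZ3.Theses.PercShatteringRace.NearLinearTwoClusterDecay :=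
  tendsto_real_twoCluster_of_sparseShellNonCertainty (criticalProbI 3) h (by norm_num)

/-- **`PercFiniteBoxLRO.CritBoxTwoArmsDecay` (stmt-CriticalPhenomena-0859) from the same hypothesis.** -/
theorem critBoxTwoArmsDecay_of_sparseShellNonCertainty
    (h : ∃ M : ℕ, 2 ≤ M ∧ ∃ σ : ℝ, 0 ≤ σ ∧ σ < 1 ∧ ∃ c : ℝ, 0 < c ∧ ∃ L : ℕ,
      ∀ᶠ N : ℕ in atTop, ∃ ℓ < L,
      (bondPercolation (zdGraph 3) (criticalProbI 3)).real
          {ω | ∃ u ∈ (↑(box 3 (M ^ ℓ * N + 1)) : Set (Site 3)) \ ↑(box 3 (M ^ ℓ * N)),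
            ∃ u' ∈ (↑(box 3 (M ^ ℓ * N + 1)) : Set (Site 3)) \ ↑(box 3 (M ^ ℓ * N)),
            ∃ v ∈ innerBoundary (zdGraph 3) (box 3 (M ^ (ℓ + 1) * N)),
            ∃ v' ∈ innerBoundary (zdGraph 3) (box 3 (M ^ (ℓ + 1) * N)),
              ω ∈ openConnIn ((↑(box 3 (M ^ (ℓ + 1) * N)) : Set (Site 3)) \ ↑(box 3 (M ^ ℓ * N))) u v ∧
              ω ∈ openConnIn ((↑(box 3 (M ^ (ℓ + 1) * N)) : Set (Site 3)) \ ↑(box 3 (M ^ ℓ * N))) u' v' ∧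
              ω ∉ openConnIn ((↑(box 3 (M ^ (ℓ + 1) * N)) : Set (Site 3)) \ ↑(box 3 (M ^ ℓ * N))) u u'}
        ≤ 1 - c / Real.log N ^ σ) :
    Summit.CriticalPhenomena.PercolationContinuityZ3.Theses.PercFiniteBoxLRO.CritBoxTwoArmsDecay :=
  fun _ hα => tendsto_real_twoCluster_of_sparseShellNonCertainty (criticalProbI 3) h hα

/-! ## The clean fixed-aspect form `NP_M` (window `L = 1`, constant defect) -/

/-- **`NearLinearTwoClusterDecay` from the CLEAN bounded-aspect non-certainty `NP_M`**: if for some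
`M ≥ 2` and `ε > 0`, for all large `N`, the shell `Λ(M N) ∖ Λ(N)` carries two shell-distinct open
clusters from its inner layer to `∂ⁱⁿΛ(M N)` with `P_{p_c}`-probability at most `1 - ε`, then the
crux holds (window `L = 1` of the companion file's constant form). -/
theorem nearLinearTwoClusterDecay_of_fixedAspectShellNonCertainty
    (h : ∃ M : ℕ, 2 ≤ M ∧ ∃ ε : ℝ, 0 < ε ∧ ∀ᶠ N : ℕ in atTop,
      (bondPercolation (zdGraph 3) (criticalProbI 3)).real
          {ω | ∃ u ∈ (↑(box 3 (N + 1)) : Set (Site 3)) \ ↑(box 3 N),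
            ∃ u' ∈ (↑(box 3 (N + 1)) : Set (Site 3)) \ ↑(box 3 N),
            ∃ v ∈ innerBoundary (zdGraph 3) (box 3 (M * N)),
            ∃ v' ∈ innerBoundary (zdGraph 3) (box 3 (M * N)),
              ω ∈ openConnIn ((↑(box 3 (M * N)) : Set (Site 3)) \ ↑(box 3 N)) u v ∧
              ω ∈ openConnIn ((↑(box 3 (M * N)) : Set (Site 3)) \ ↑(box 3 N)) u' v' ∧
              ω ∉ openConnIn ((↑(box 3 (M * N)) : Set (Site 3)) \ ↑(box 3 N)) u u'}
        ≤ 1 - ε) :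
    Summit.CriticalPhenomena.PercolationContinuityZ3.Theses.PercShatteringRace.NearLinearTwoClusterDecay := by
  obtain ⟨M, hM, ε, hε, hev⟩ := h
  refine nearLinearTwoClusterDecay_of_shellNonCertainty ⟨M, hM, ε, hε, 1, ?_⟩
  filter_upwards [hev] with N hN
  refine ⟨0, Nat.one_pos, ?_⟩
  have e0 : M ^ 0 * N = N := by ring
  have e1 : M ^ (0 + 1) * N = M * N := by ring
  rw [e0, e1]
  exact hN

/-- **`PercFiniteBoxLRO.CritBoxTwoArmsDecay` (stmt-CriticalPhenomena-0859) from the clean `NP_M`.** -/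
theorem critBoxTwoArmsDecay_of_fixedAspectShellNonCertainty
    (h : ∃ M : ℕ, 2 ≤ M ∧ ∃ ε : ℝ, 0 < ε ∧ ∀ᶠ N : ℕ in atTop,
      (bondPercolation (zdGraph 3) (criticalProbI 3)).real
          {ω | ∃ u ∈ (↑(box 3 (N + 1)) : Set (Site 3)) \ ↑(box 3 N),
            ∃ u' ∈ (↑(box 3 (N + 1)) : Set (Site 3)) \ ↑(box 3 N),
            ∃ v ∈ innerBoundary (zdGraph 3) (box 3 (M * N)),
            ∃ v' ∈ innerBoundary (zdGraph 3) (box 3 (M * N)),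
              ω ∈ openConnIn ((↑(box 3 (M * N)) : Set (Site 3)) \ ↑(box 3 N)) u v ∧
              ω ∈ openConnIn ((↑(box 3 (M * N)) : Set (Site 3)) \ ↑(box 3 N)) u' v' ∧
              ω ∉ openConnIn ((↑(box 3 (M * N)) : Set (Site 3)) \ ↑(box 3 N)) u u'}
        ≤ 1 - ε) :
    Summit.CriticalPhenomena.PercolationContinuityZ3.Theses.PercFiniteBoxLRO.CritBoxTwoArmsDecay := by
  obtain ⟨M, hM, ε, hε, hev⟩ := h
  refine critBoxTwoArmsDecay_of_shellNonCertainty ⟨M, hM, ε, hε, 1, ?_⟩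
  filter_upwards [hev] with N hN
  refine ⟨0, Nat.one_pos, ?_⟩
  have e0 : M ^ 0 * N = N := by ring
  have e1 : M ^ (0 + 1) * N = M * N := by ring
  rw [e0, e1]
  exact hN

end Summit.CriticalPhenomena.PercolationContinuityZ3.Theorems

end
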